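import Literature.Analysis.FluidPDE.SuitableWeak
import Literature.Analysis.FluidPDE.WeakSolutionProofs
import HarnessLib

/-!
# Space–time rescaling of weak solutions (parabolic scaling, translation, change of viscosity)

Analysis/FluidPDE support file. The Navier–Stokes system
`∂ₜu + (u·∇)u + ∇p = νΔu + f`, `div u = 0` is covariant under the space–time affine maps
`Φ(s, y) = (t₀ + β s, x₀ + γ y)` (`β, γ > 0`): if `(u, p)` solves the system with viscosity `ν`
on an open region `Q ⊆ ℝ × E`, then for every `α > 0` with `β = α γ` the pair
`w(s, y) = α u(Φ(s, y))`, `q(s, y) = α² p(Φ(s, y))` solves it on `Φ⁻¹(Q)` with viscosity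
`μ = α ν / γ` and force `α² γ f ∘ Φ`. The choice `α = γ = R`, `β = R²` is the classical
parabolic scaling `u(x, t) ↦ R u(x₀ + R x, t₀ + R² t)` (Caffarelli–Kohn–Nirenberg 1982, §2;
Escauriaza–Seregin–Šverák 2003, §3: "making obvious scaling `ṽ(x,t) = R v(x₀ + R x, t₀ + R² t)`,
`p̃(x,t) = R² p(x₀ + R x, t₀ + R² t)`"), and `α = R/ν`, `β = R²/ν`, `γ = R` normalises the
viscosity to `1` on the unit cylinder.

This file proves the covariance, under these maps, of the accepted notions the local regularity
theory is phrased in: space–time test fields (`Fluid.IsSpaceTimeTestOn`) with the chain rules for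
`Fluid.timeDeriv`, `fderiv`, `gradient`, `Fluid.divergence`, `Fluid.convect` and the Laplacian;
local integrability on `Q`; distributional solutions (`Fluid.IsDistributionalNSSolutionOn`);
weak spatial gradients (`Fluid.HasWeakSpatialGradientOn`, with `G' = (αγ) • G ∘ Φ`) and their
`L²` dissipation integrals; space–time `L^r` integrals and sliced `L^r` bounds
`ess sup_t ∫_B |u|^r`; a.e. statements. Everything is elementary change of variables (the
push-forward of Lebesgue measure under `Φ` is `(β γⁿ)⁻¹ •` Lebesgue measure, `n = dim E`) and
the chain rule.

## Contents

* `Fluid.stAffine β γ t₀ x₀`, `Fluid.stLinear`, `Fluid.stAffineHomeomorph`, `Fluid.stPreimage` —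
  the maps `Φ`, their linear parts, `Φ` as a homeomorphism, and `Φ⁻¹(Q)` as an open set;
  `Fluid.stAffine_preimage_cylinder_eq_parabolicCylinder` — the viscosity-normalising map takes
  the standard cylinder `Q(ρ/R)` onto `Q_ν(z₀, ρ) = (t₀ - ρ²/ν, t₀) × B(x₀, ρ)`.
* `Fluid.map_stAffine_volume` and the change-of-variables formulas for `∫`, `∫⁻` (whole space,
  sets, iterated `∫ dt ∫ dx`), their one-variable (time only / space only) versions, and transport
  of a.e. statements in both directions (`Fluid.ae_restrict_preimage_stAffine`,
  `Fluid.ae_restrict_of_ae_restrict_preimage_stAffine`).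
* `Fluid.stPull β γ t₀ x₀ ψ = ψ ∘ Φ`, `Fluid.IsSpaceTimeTestOn.stPull` / `.stPull_symm` and the
  chain rules `timeDeriv_stPull`, `fderiv_stPull`, `gradient_stPull`, `divergence_stPull`,
  `convect_stPull`, `laplacian_stPull`.
* `MeasureTheory.LocallyIntegrableOn.comp_stAffine` — local integrability under `Φ`.
* `Fluid.IsDistributionalNSSolutionOn.stRescale` — covariance of distributional solutions.
* `Fluid.HasWeakSpatialGradientOn.stRescale`, `Fluid.setLIntegral_frobeniusNormSq_stRescale` —
  covariance of weak spatial gradients and of the dissipation `∫∫ |∇u|²`.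
* `Fluid.setLIntegral_enorm_rpow_stRescale`, `Fluid.setLIntegral_enorm_pow_stRescale`,
  `Fluid.ae_sliced_setLIntegral_ball_stRescale` — covariance of `∫∫ ‖u‖^r` and of sliced bounds
  `ess sup_t ∫_B ‖u(t)‖^r`.

## References

* L. Caffarelli, R. Kohn, L. Nirenberg, *Partial regularity of suitable weak solutions of the
  Navier–Stokes equations*, Comm. Pure Appl. Math. 35 (1982), §2 (scaling of suitable weak
  solutions).
* L. Escauriaza, G. Seregin, V. Šverák, *`L_{3,∞}`-solutions of Navier–Stokes equations and
  backward uniqueness*, Russ. Math. Surveys 58:2 (2003), §3 (proof of Thm. 1.3: scaling to the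
  unit cylinder).
* G. Seregin, *Lecture notes on regularity theory for the Navier–Stokes equations* (2014), §6.1
  (Navier–Stokes scaling `v^λ(y,s) = λ v(λ y, λ² s)`, `q^λ = λ² q`).
-/

noncomputable section

open MeasureTheory TopologicalSpace Set Function Filter Topology Module Metric
open scoped InnerProductSpace RealInnerProductSpace ENNReal NNReal Laplacian

namespace Literature.Analysis.FluidPDE

/-! ### The space–time affine maps -/

section Affine

variable {E : Type*} [NormedAddCommGroup E] [InnerProductSpace ℝ E]

/-- The space–time affine map `Φ(s, y) = (t₀ + β s, x₀ + γ y)` (time dilation `β`, space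
dilation `γ`, translation to `(t₀, x₀)`), time first. For `β = R²`, `γ = R` this is the change
of variables of the parabolic scaling `ṽ(x, t) = R v(x₀ + R x, t₀ + R² t)`
(Escauriaza–Seregin–Šverák 2003, §3). [cite: EscauriazaSereginSverak2003, §3] -/
def stAffine (β γ t₀ : ℝ) (x₀ : E) (z : ℝ × E) : ℝ × E :=
  (t₀ + β * z.1, x₀ + γ • z.2)

/-- Unfolding `stAffine`. [folklore] -/
@[simp]
theorem stAffine_apply (β γ t₀ : ℝ) (x₀ : E) (s : ℝ) (y : E) :
    stAffine β γ t₀ x₀ (s, y) = (t₀ + β * s, x₀ + γ • y) :=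
  rfl

/-- First component of `stAffine`. [folklore] -/
@[simp]
theorem stAffine_fst (β γ t₀ : ℝ) (x₀ : E) (z : ℝ × E) :
    (stAffine β γ t₀ x₀ z).1 = t₀ + β * z.1 :=
  rfl

/-- Second component of `stAffine`. [folklore] -/
@[simp]
theorem stAffine_snd (β γ t₀ : ℝ) (x₀ : E) (z : ℝ × E) :
    (stAffine β γ t₀ x₀ z).2 = x₀ + γ • z.2 :=
  rfl

/-- The linear part `L(s, y) = (β s, γ y)` of the space–time affine map. [folklore] -/
def stLinear (β γ : ℝ) : (ℝ × E) →ₗ[ℝ] (ℝ × E) :=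
  (β • LinearMap.id).prodMap (γ • LinearMap.id)

/-- Unfolding `stLinear`. [folklore] -/
@[simp]
theorem stLinear_apply (β γ : ℝ) (z : ℝ × E) :
    stLinear (E := E) β γ z = (β * z.1, γ • z.2) := by
  simp [stLinear, LinearMap.prodMap_apply]

/-- `Φ = (translation by (t₀, x₀)) ∘ L`. [folklore] -/
theorem stAffine_eq_add_comp_stLinear (β γ t₀ : ℝ) (x₀ : E) :
    stAffine β γ t₀ x₀ = (fun z => ((t₀, x₀) : ℝ × E) + z) ∘ stLinear (E := E) β γ := by
  funext z; simp [stAffine]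

/-- `det L = β γⁿ`, `n = dim E`. [folklore] -/
theorem det_stLinear [FiniteDimensional ℝ E] (β γ : ℝ) :
    LinearMap.det (stLinear (E := E) β γ) = β * γ ^ finrank ℝ E := by
  rw [stLinear, LinearMap.det_prodMap, LinearMap.det_smul, LinearMap.det_smul, LinearMap.det_id,
    LinearMap.det_id]
  simp

/-- `Φ` is continuous. [folklore] -/
theorem continuous_stAffine (β γ t₀ : ℝ) (x₀ : E) : Continuous (stAffine β γ t₀ x₀) := by
  unfold stAffine; fun_prop

/-- `Φ` is smooth. [folklore] -/
theorem contDiff_stAffine {n : WithTop ℕ∞} (β γ t₀ : ℝ) (x₀ : E) :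
    ContDiff ℝ n (stAffine β γ t₀ x₀) := by
  unfold stAffine; fun_prop

/-- `Φ` is measurable. [folklore] -/
theorem measurable_stAffine [MeasurableSpace E] [BorelSpace E] (β γ t₀ : ℝ) (x₀ : E) :
    Measurable (stAffine β γ t₀ x₀) := by
  borelize E
  exact (continuous_stAffine β γ t₀ x₀).measurable

/-- The space–time affine map as a homeomorphism (`β, γ ≠ 0`), with inverse
`Φ⁻¹(t, x) = (β⁻¹ (t - t₀), γ⁻¹ (x - x₀))`. [folklore] -/
def stAffineHomeomorph {β γ : ℝ} (hβ : β ≠ 0) (hγ : γ ≠ 0) (t₀ : ℝ) (x₀ : E) :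
    (ℝ × E) ≃ₜ (ℝ × E) where
  toFun := stAffine β γ t₀ x₀
  invFun z := (β⁻¹ * (z.1 - t₀), γ⁻¹ • (z.2 - x₀))
  left_inv z := by
    rcases z with ⟨s, y⟩
    simp [stAffine, hβ, hγ, smul_smul]
  right_inv z := by
    rcases z with ⟨t, x⟩
    simp [stAffine, hβ, hγ, smul_smul, mul_inv_cancel₀]
  continuous_toFun := continuous_stAffine β γ t₀ x₀
  continuous_invFun := by fun_prop

/-- The homeomorphism is `Φ`. [folklore] -/
@[simp]
theorem stAffineHomeomorph_apply {β γ : ℝ} (hβ : β ≠ 0) (hγ : γ ≠ 0) (t₀ : ℝ) (x₀ : E)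
    (z : ℝ × E) : stAffineHomeomorph hβ hγ t₀ x₀ z = stAffine β γ t₀ x₀ z :=
  rfl

/-- The inverse homeomorphism is `Φ⁻¹(t, x) = (β⁻¹ (t - t₀), γ⁻¹ (x - x₀))`. [folklore] -/
theorem stAffineHomeomorph_symm_apply {β γ : ℝ} (hβ : β ≠ 0) (hγ : γ ≠ 0) (t₀ : ℝ) (x₀ : E)
    (z : ℝ × E) :
    (stAffineHomeomorph hβ hγ t₀ x₀).symm z = (β⁻¹ * (z.1 - t₀), γ⁻¹ • (z.2 - x₀)) :=
  rfl

/-- The inverse of `Φ` is again a space–time affine map: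
`Φ⁻¹ = stAffine β⁻¹ γ⁻¹ (-β⁻¹ t₀) (-γ⁻¹ x₀)`. [folklore] -/
theorem stAffineHomeomorph_symm_eq {β γ : ℝ} (hβ : β ≠ 0) (hγ : γ ≠ 0) (t₀ : ℝ) (x₀ : E) :
    ⇑(stAffineHomeomorph hβ hγ t₀ x₀).symm = stAffine β⁻¹ γ⁻¹ (-(β⁻¹ * t₀)) (-(γ⁻¹ • x₀)) := by
  funext z
  rw [stAffineHomeomorph_symm_apply]
  rcases z with ⟨t, x⟩
  simp only [stAffine_apply, smul_sub, Prod.mk.injEq]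
  constructor
  · ring
  · abel

/-- `Φ ∘ Φ⁻¹ = id` pointwise, in `stAffine` form. [folklore] -/
@[simp]
theorem stAffine_apply_symm {β γ : ℝ} (hβ : β ≠ 0) (hγ : γ ≠ 0) (t₀ : ℝ) (x₀ : E) (z : ℝ × E) :
    stAffine β γ t₀ x₀ ((stAffineHomeomorph hβ hγ t₀ x₀).symm z) = z :=
  (stAffineHomeomorph hβ hγ t₀ x₀).apply_symm_apply z

/-- `Φ⁻¹ ∘ Φ = id` pointwise. [folklore] -/
@[simp]
theorem stAffineHomeomorph_symm_apply_stAffine {β γ : ℝ} (hβ : β ≠ 0) (hγ : γ ≠ 0) (t₀ : ℝ)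
    (x₀ : E) (z : ℝ × E) :
    (stAffineHomeomorph hβ hγ t₀ x₀).symm (stAffine β γ t₀ x₀ z) = z :=
  (stAffineHomeomorph hβ hγ t₀ x₀).symm_apply_apply z

/-- The preimage `Φ⁻¹(Q)` of an open space–time region under `Φ`, as an open set. [folklore] -/
def stPreimage (β γ t₀ : ℝ) (x₀ : E) (Q : Opens (ℝ × E)) : Opens (ℝ × E) :=
  ⟨stAffine β γ t₀ x₀ ⁻¹' (Q : Set (ℝ × E)), Q.isOpen.preimage (continuous_stAffine β γ t₀ x₀)⟩

/-- Underlying set of `stPreimage`. [folklore] -/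
@[simp]
theorem coe_stPreimage (β γ t₀ : ℝ) (x₀ : E) (Q : Opens (ℝ × E)) :
    ((stPreimage β γ t₀ x₀ Q : Opens (ℝ × E)) : Set (ℝ × E)) =
      stAffine β γ t₀ x₀ ⁻¹' (Q : Set (ℝ × E)) :=
  rfl

/-- Membership in `stPreimage`. [folklore] -/
@[simp]
theorem mem_stPreimage {β γ t₀ : ℝ} {x₀ : E} {Q : Opens (ℝ × E)} {z : ℝ × E} :
    z ∈ stPreimage β γ t₀ x₀ Q ↔ stAffine β γ t₀ x₀ z ∈ Q :=
  Iff.rfl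

/-- `Φ⁻¹(Φ'⁻¹(Q)) = Q` for `Φ' = Φ⁻¹`: the preimage under the inverse map undoes `stPreimage`. [folklore] -/
theorem stPreimage_symm_stPreimage {β γ : ℝ} (hβ : β ≠ 0) (hγ : γ ≠ 0) (t₀ : ℝ) (x₀ : E)
    (Q : Opens (ℝ × E)) :
    stPreimage β γ t₀ x₀ (stPreimage β⁻¹ γ⁻¹ (-(β⁻¹ * t₀)) (-(γ⁻¹ • x₀)) Q) = Q := by
  ext z
  simp only [coe_stPreimage, mem_preimage, SetLike.mem_coe]
  rw [← stAffineHomeomorph_symm_eq hβ hγ, stAffineHomeomorph_symm_apply_stAffine]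

/-- `Φ'⁻¹(Φ⁻¹(Q)) = Q` for `Φ' = Φ⁻¹`. [folklore] -/
theorem stPreimage_stPreimage_symm {β γ : ℝ} (hβ : β ≠ 0) (hγ : γ ≠ 0) (t₀ : ℝ) (x₀ : E)
    (Q : Opens (ℝ × E)) :
    stPreimage β⁻¹ γ⁻¹ (-(β⁻¹ * t₀)) (-(γ⁻¹ • x₀)) (stPreimage β γ t₀ x₀ Q) = Q := by
  ext z
  simp only [coe_stPreimage, mem_preimage, SetLike.mem_coe]
  rw [← stAffineHomeomorph_symm_eq hβ hγ, stAffine_apply_symm]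

/-- **Preimages of cylinders.** `Φ⁻¹((T₁, T₀) × B(x₁, R)) = ((T₁ - t₀)/β, (T₀ - t₀)/β) × B(γ⁻¹(x₁ - x₀), R/γ)`
for `β, γ > 0`. [folklore] -/
theorem stAffine_preimage_cylinder {β γ : ℝ} (hβ : 0 < β) (hγ : 0 < γ) (t₀ : ℝ) (x₀ x₁ : E)
    (T₁ T₀ R : ℝ) :
    stAffine β γ t₀ x₀ ⁻¹' (Ioo T₁ T₀ ×ˢ ball x₁ R) =
      Ioo ((T₁ - t₀) / β) ((T₀ - t₀) / β) ×ˢ ball (γ⁻¹ • (x₁ - x₀)) (R / γ) := by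
  ext ⟨s, y⟩
  simp only [mem_preimage, stAffine_apply, mem_prod, mem_Ioo, mem_ball]
  have h1 : T₁ < t₀ + β * s ∧ t₀ + β * s < T₀ ↔ (T₁ - t₀) / β < s ∧ s < (T₀ - t₀) / β := by
    rw [div_lt_iff₀ hβ, lt_div_iff₀ hβ]
    constructor <;> rintro ⟨h₁, h₂⟩ <;> constructor <;> linarith
  have h2 : dist (x₀ + γ • y) x₁ < R ↔ dist y (γ⁻¹ • (x₁ - x₀)) < R / γ := by
    rw [lt_div_iff₀ hγ, dist_eq_norm, dist_eq_norm]
    have : x₀ + γ • y - x₁ = γ • (y - γ⁻¹ • (x₁ - x₀)) := by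
      rw [smul_sub, smul_smul, mul_inv_cancel₀ hγ.ne', one_smul]; abel
    rw [this, norm_smul, Real.norm_eq_abs, abs_of_pos hγ, mul_comm]
  rw [h1, h2]

/-- **Preimage of a parabolic cylinder under the viscosity-normalising map.** With
`Φ(s, y) = (t₀ + (R²/ν) s, x₀ + R y)`, the preimage of the `ν`-cylinder
`Q_ν(z₀, ρ) = (t₀ - ρ²/ν, t₀) × B(x₀, ρ)` is the standard cylinder `Q(ρ/R) = (-(ρ/R)², 0) × B(0, ρ/R)`
(`Fluid.parabolicCylinder (ρ/R) 0`). [folklore] -/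
theorem stAffine_preimage_cylinder_eq_parabolicCylinder {ν R : ℝ} (hν : 0 < ν) (hR : 0 < R)
    (t₀ : ℝ) (x₀ : E) (ρ : ℝ) :
    stAffine (R ^ 2 / ν) R t₀ x₀ ⁻¹' (Ioo (t₀ - ρ ^ 2 / ν) t₀ ×ˢ ball x₀ ρ) =
      parabolicCylinder (ρ / R) ((0 : ℝ), (0 : E)) := by
  rw [stAffine_preimage_cylinder (by positivity) hR, parabolicCylinder]
  congr 1
  · congr 1
    · field_simp
      ring
    · simp
  · rw [sub_self, smul_zero]

variable [FiniteDimensional ℝ E] [MeasurableSpace E] [BorelSpace E]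

/-- **The space–time affine map scales Lebesgue measure by `(β γⁿ)⁻¹`**: the push-forward of
`volume` under `Φ(s, y) = (t₀ + β s, x₀ + γ y)`, `β, γ > 0`, is `(β γⁿ)⁻¹ • volume`,
`n = dim E`. [folklore] -/
theorem map_stAffine_volume {β γ : ℝ} (hβ : 0 < β) (hγ : 0 < γ) (t₀ : ℝ) (x₀ : E) :
    Measure.map (stAffine β γ t₀ x₀) (volume : Measure (ℝ × E)) =
      ENNReal.ofReal (β * γ ^ finrank ℝ E)⁻¹ • volume := by
  haveI : (volume : Measure (ℝ × E)).IsAddHaarMeasure := by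
    rw [Measure.volume_eq_prod]; infer_instance
  have hdet : LinearMap.det (stLinear (E := E) β γ) ≠ 0 := by
    rw [det_stLinear]; positivity
  have hL : Measurable (stLinear (E := E) β γ) :=
    (stLinear (E := E) β γ).continuous_of_finiteDimensional.measurable
  rw [stAffine_eq_add_comp_stLinear, ← Measure.map_map (measurable_const_add _) hL]
  have h1 : Measure.map (stLinear (E := E) β γ) (volume : Measure (ℝ × E)) =
      ENNReal.ofReal |(LinearMap.det (stLinear (E := E) β γ))⁻¹| • volume :=
    Measure.map_linearMap_addHaar_eq_smul_addHaar volume hdet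
  rw [h1, Measure.map_smul, map_add_left_eq_self, det_stLinear, abs_of_pos (by positivity)]

/-- `Φ` is a measurable embedding (it is a homeomorphism). [folklore] -/
theorem measurableEmbedding_stAffine {β γ : ℝ} (hβ : β ≠ 0) (hγ : γ ≠ 0) (t₀ : ℝ) (x₀ : E) :
    MeasurableEmbedding (stAffine β γ t₀ x₀) :=
  (stAffineHomeomorph hβ hγ t₀ x₀).measurableEmbedding

/-- `Φ` is quasi-measure-preserving for Lebesgue measure (`β, γ > 0`). [folklore] -/
theorem quasiMeasurePreserving_stAffine {β γ : ℝ} (hβ : 0 < β) (hγ : 0 < γ) (t₀ : ℝ) (x₀ : E) :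
    Measure.QuasiMeasurePreserving (stAffine β γ t₀ x₀) (volume : Measure (ℝ × E)) volume := by
  refine ⟨measurable_stAffine β γ t₀ x₀, ?_⟩
  rw [map_stAffine_volume hβ hγ]
  exact Measure.smul_absolutelyContinuous

/-- The restriction of Lebesgue measure to `Φ⁻¹(S)`, pushed forward by `Φ`, is `(β γⁿ)⁻¹ •` the
restriction to `S`. [folklore] -/
theorem map_stAffine_volume_restrict_preimage {β γ : ℝ} (hβ : 0 < β) (hγ : 0 < γ) (t₀ : ℝ)
    (x₀ : E) (S : Set (ℝ × E)) :
    Measure.map (stAffine β γ t₀ x₀) (volume.restrict (stAffine β γ t₀ x₀ ⁻¹' S)) =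
      ENNReal.ofReal (β * γ ^ finrank ℝ E)⁻¹ • volume.restrict S := by
  rw [← (measurableEmbedding_stAffine hβ.ne' hγ.ne' t₀ x₀).restrict_map, map_stAffine_volume hβ hγ,
    Measure.restrict_smul]

/-- Change of variables in space–time integrals under the affine map:
`∫ F(Φ z) dz = (β γⁿ)⁻¹ ∫ F(z) dz` (Bochner; no measurability of `F` needed). [folklore] -/
theorem integral_comp_stAffine {G : Type*} [NormedAddCommGroup G] [NormedSpace ℝ G]
    {β γ : ℝ} (hβ : 0 < β) (hγ : 0 < γ) (t₀ : ℝ) (x₀ : E) (F : ℝ × E → G) :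
    ∫ z, F (stAffine β γ t₀ x₀ z) = (β * γ ^ finrank ℝ E)⁻¹ • ∫ z, F z := by
  have := (measurableEmbedding_stAffine hβ.ne' hγ.ne' t₀ x₀).integral_map
    (μ := (volume : Measure (ℝ × E))) F
  rw [← this, map_stAffine_volume hβ hγ, integral_smul_measure,
    ENNReal.toReal_ofReal (by positivity)]

/-- Change of variables in space–time lower integrals under the affine map:
`∫⁻ F(Φ z) dz = (β γⁿ)⁻¹ ∫⁻ F(z) dz`. [folklore] -/
theorem lintegral_comp_stAffine {β γ : ℝ} (hβ : 0 < β) (hγ : 0 < γ) (t₀ : ℝ) (x₀ : E)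
    (F : ℝ × E → ℝ≥0∞) :
    ∫⁻ z, F (stAffine β γ t₀ x₀ z) = ENNReal.ofReal (β * γ ^ finrank ℝ E)⁻¹ * ∫⁻ z, F z := by
  have := (measurableEmbedding_stAffine hβ.ne' hγ.ne' t₀ x₀).lintegral_map
    (μ := (volume : Measure (ℝ × E))) F
  rw [← this, map_stAffine_volume hβ hγ, lintegral_smul_measure, smul_eq_mul]

/-- Change of variables in space–time set integrals: `∫_{Φ⁻¹ S} F(Φ z) dz = (β γⁿ)⁻¹ ∫_S F`. [folklore] -/
theorem setIntegral_preimage_comp_stAffine {G : Type*} [NormedAddCommGroup G] [NormedSpace ℝ G]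
    {β γ : ℝ} (hβ : 0 < β) (hγ : 0 < γ) (t₀ : ℝ) (x₀ : E) (F : ℝ × E → G) (S : Set (ℝ × E)) :
    ∫ z in stAffine β γ t₀ x₀ ⁻¹' S, F (stAffine β γ t₀ x₀ z) =
      (β * γ ^ finrank ℝ E)⁻¹ • ∫ z in S, F z := by
  have := (measurableEmbedding_stAffine hβ.ne' hγ.ne' t₀ x₀).setIntegral_map
    (μ := (volume : Measure (ℝ × E))) F S
  rw [← this, map_stAffine_volume hβ hγ, Measure.restrict_smul, integral_smul_measure,
    ENNReal.toReal_ofReal (by positivity)]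

/-- Change of variables in space–time set lower integrals:
`∫⁻_{Φ⁻¹ S} F(Φ z) dz = (β γⁿ)⁻¹ ∫⁻_S F`. [folklore] -/
theorem setLIntegral_preimage_comp_stAffine {β γ : ℝ} (hβ : 0 < β) (hγ : 0 < γ) (t₀ : ℝ)
    (x₀ : E) (F : ℝ × E → ℝ≥0∞) (S : Set (ℝ × E)) :
    ∫⁻ z in stAffine β γ t₀ x₀ ⁻¹' S, F (stAffine β γ t₀ x₀ z) =
      ENNReal.ofReal (β * γ ^ finrank ℝ E)⁻¹ * ∫⁻ z in S, F z := by
  have h2 := (measurableEmbedding_stAffine hβ.ne' hγ.ne' t₀ x₀).lintegral_map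
    (μ := (volume : Measure (ℝ × E)).restrict (stAffine β γ t₀ x₀ ⁻¹' S)) F
  rw [← h2, map_stAffine_volume_restrict_preimage hβ hγ, lintegral_smul_measure, smul_eq_mul]

/-- Transport of a.e. statements on a set: if `P` holds a.e. on `S`, then `P ∘ Φ` holds a.e. on
`Φ⁻¹(S)`. [folklore] -/
theorem ae_restrict_preimage_stAffine {β γ : ℝ} (hβ : 0 < β) (hγ : 0 < γ) (t₀ : ℝ) (x₀ : E)
    {S : Set (ℝ × E)} {P : ℝ × E → Prop} (h : ∀ᵐ z ∂(volume.restrict S), P z) :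
    ∀ᵐ z ∂(volume.restrict (stAffine β γ t₀ x₀ ⁻¹' S)), P (stAffine β γ t₀ x₀ z) := by
  have hme := measurableEmbedding_stAffine hβ.ne' hγ.ne' t₀ x₀
  have h' : ∀ᵐ z ∂(Measure.map (stAffine β γ t₀ x₀)
      (volume.restrict (stAffine β γ t₀ x₀ ⁻¹' S))), P z := by
    rw [map_stAffine_volume_restrict_preimage hβ hγ]
    exact Measure.ae_smul_measure h _
  exact hme.ae_map_iff.1 h'

end Affine

/-! ### One-variable changes of variables: time only, space only -/

section SpaceAffine

variable {E : Type*} [NormedAddCommGroup E] [InnerProductSpace ℝ E]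

/-- The space affine map `y ↦ x₀ + γ y` as a homeomorphism (`γ ≠ 0`). [folklore] -/
def spaceAffineHomeomorph {γ : ℝ} (hγ : γ ≠ 0) (x₀ : E) : E ≃ₜ E where
  toFun y := x₀ + γ • y
  invFun x := γ⁻¹ • (x - x₀)
  left_inv y := by simp [smul_smul, hγ]
  right_inv x := by simp [smul_smul, hγ, mul_inv_cancel₀]
  continuous_toFun := by fun_prop
  continuous_invFun := by fun_prop

/-- The space homeomorphism is `y ↦ x₀ + γ y`. [folklore] -/
@[simp]
theorem spaceAffineHomeomorph_apply {γ : ℝ} (hγ : γ ≠ 0) (x₀ y : E) :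
    spaceAffineHomeomorph hγ x₀ y = x₀ + γ • y :=
  rfl

/-- The space homeomorphism as a function. [folklore] -/
theorem coe_spaceAffineHomeomorph {γ : ℝ} (hγ : γ ≠ 0) (x₀ : E) :
    ⇑(spaceAffineHomeomorph hγ x₀) = fun y => x₀ + γ • y :=
  rfl

/-- The preimage of a ball under `y ↦ x₀ + γ y` (`γ > 0`). [folklore] -/
theorem space_affine_preimage_ball {γ : ℝ} (hγ : 0 < γ) (x₀ x₁ : E) (R : ℝ) :
    (fun y : E => x₀ + γ • y) ⁻¹' ball x₁ R = ball (γ⁻¹ • (x₁ - x₀)) (R / γ) := by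
  ext y
  simp only [mem_preimage, mem_ball]
  rw [lt_div_iff₀ hγ, dist_eq_norm, dist_eq_norm]
  have : x₀ + γ • y - x₁ = γ • (y - γ⁻¹ • (x₁ - x₀)) := by
    rw [smul_sub, smul_smul, mul_inv_cancel₀ hγ.ne', one_smul]; abel
  rw [this, norm_smul, Real.norm_eq_abs, abs_of_pos hγ, mul_comm]

end SpaceAffine

section OneVariable

variable {E : Type*} [NormedAddCommGroup E] [InnerProductSpace ℝ E] [FiniteDimensional ℝ E]
  [MeasurableSpace E] [BorelSpace E]

/-- Time change of variables on the whole line: `∫ g(t₀ + β s) ds = β⁻¹ ∫ g(t) dt` (`β > 0`). [folklore] -/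
theorem integral_comp_time_affine {G : Type*} [NormedAddCommGroup G] [NormedSpace ℝ G]
    {β : ℝ} (hβ : 0 < β) (t₀ : ℝ) (g : ℝ → G) :
    ∫ s, g (t₀ + β * s) = β⁻¹ • ∫ t, g t := by
  have h1 : ∫ s, g (t₀ + β * s) = |β⁻¹| • ∫ y, g (t₀ + y) :=
    Measure.integral_comp_mul_left (fun y => g (t₀ + y)) β
  rw [h1, abs_of_pos (inv_pos.2 hβ)]
  congr 1
  exact integral_add_left_eq_self g t₀

/-- Time change of variables on an interval: `∫_{(a, b)} g(t₀ + β s) ds = β⁻¹ ∫_{(t₀ + βa, t₀ + βb)} g`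
(`β > 0`). [folklore] -/
theorem setIntegral_Ioo_comp_time_affine {G : Type*} [NormedAddCommGroup G] [NormedSpace ℝ G]
    {β : ℝ} (hβ : 0 < β) (t₀ a b : ℝ) (g : ℝ → G) :
    ∫ s in Ioo a b, g (t₀ + β * s) = β⁻¹ • ∫ t in Ioo (t₀ + β * a) (t₀ + β * b), g t := by
  rw [← integral_indicator measurableSet_Ioo, ← integral_indicator measurableSet_Ioo]
  have : (fun s => (Ioo a b).indicator (fun s => g (t₀ + β * s)) s) =
      fun s => (Ioo (t₀ + β * a) (t₀ + β * b)).indicator g (t₀ + β * s) := by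
    funext s
    by_cases hs : s ∈ Ioo a b
    · rw [indicator_of_mem hs, indicator_of_mem]
      exact ⟨by nlinarith [hs.1], by nlinarith [hs.2]⟩
    · rw [indicator_of_notMem hs, indicator_of_notMem]
      rintro ⟨h₁, h₂⟩
      exact hs ⟨by nlinarith, by nlinarith⟩
  rw [this, integral_comp_time_affine hβ]

/-- The push-forward of Lebesgue measure on `E` under `y ↦ x₀ + γ y`, `γ > 0`, is
`(γⁿ)⁻¹ • volume`. [folklore] -/
theorem map_space_affine_volume {γ : ℝ} (hγ : 0 < γ) (x₀ : E) :
    Measure.map (fun y : E => x₀ + γ • y) (volume : Measure E) =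
      ENNReal.ofReal (γ ^ finrank ℝ E)⁻¹ • volume := by
  have h1 : (fun y : E => x₀ + γ • y) = (fun x => x₀ + x) ∘ fun y : E => γ • y := rfl
  rw [h1, ← Measure.map_map (measurable_const_add x₀) (measurable_const_smul γ),
    Measure.map_addHaar_smul volume hγ.ne', Measure.map_smul, map_add_left_eq_self,
    abs_of_pos (by positivity)]

/-- Space change of variables (Bochner): `∫ F(x₀ + γ y) dy = (γⁿ)⁻¹ ∫ F(x) dx` (`γ > 0`). [folklore] -/
theorem integral_comp_space_affine {G : Type*} [NormedAddCommGroup G] [NormedSpace ℝ G]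
    {γ : ℝ} (hγ : 0 < γ) (x₀ : E) (F : E → G) :
    ∫ y, F (x₀ + γ • y) = (γ ^ finrank ℝ E)⁻¹ • ∫ x, F x := by
  have hme := (spaceAffineHomeomorph hγ.ne' x₀).measurableEmbedding
  have := hme.integral_map (μ := (volume : Measure E)) F
  rw [coe_spaceAffineHomeomorph] at this
  rw [← this, map_space_affine_volume hγ, integral_smul_measure,
    ENNReal.toReal_ofReal (by positivity)]

/-- Space change of variables (lower integral): `∫⁻ F(x₀ + γ y) dy = (γⁿ)⁻¹ ∫⁻ F(x) dx`
(`γ > 0`). [folklore] -/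
theorem lintegral_comp_space_affine {γ : ℝ} (hγ : 0 < γ) (x₀ : E) (F : E → ℝ≥0∞) :
    ∫⁻ y, F (x₀ + γ • y) = ENNReal.ofReal (γ ^ finrank ℝ E)⁻¹ * ∫⁻ x, F x := by
  have hme := (spaceAffineHomeomorph hγ.ne' x₀).measurableEmbedding
  have := hme.lintegral_map (μ := (volume : Measure E)) F
  rw [coe_spaceAffineHomeomorph] at this
  rw [← this, map_space_affine_volume hγ, lintegral_smul_measure, smul_eq_mul]

/-- Space change of variables (lower integral over a set):
`∫⁻_{A⁻¹ S} F(x₀ + γ y) dy = (γⁿ)⁻¹ ∫⁻_S F`, `A y = x₀ + γ y` (`γ > 0`). [folklore] -/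
theorem setLIntegral_preimage_comp_space_affine {γ : ℝ} (hγ : 0 < γ) (x₀ : E) (F : E → ℝ≥0∞)
    (S : Set E) :
    ∫⁻ y in (fun y : E => x₀ + γ • y) ⁻¹' S, F (x₀ + γ • y) =
      ENNReal.ofReal (γ ^ finrank ℝ E)⁻¹ * ∫⁻ x in S, F x := by
  have hme := (spaceAffineHomeomorph hγ.ne' x₀).measurableEmbedding
  have h1 := hme.restrict_map (volume : Measure E) S
  have h2 := hme.lintegral_map
    (μ := (volume : Measure E).restrict ((fun y : E => x₀ + γ • y) ⁻¹' S)) F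
  rw [coe_spaceAffineHomeomorph] at h1 h2
  rw [← h2, ← h1, map_space_affine_volume hγ, Measure.restrict_smul, lintegral_smul_measure,
    smul_eq_mul]

/-- Time quasi-invariance: `s ↦ t₀ + β s` (`β > 0`) is quasi-measure-preserving. [folklore] -/
theorem quasiMeasurePreserving_time_affine {β : ℝ} (hβ : 0 < β) (t₀ : ℝ) :
    Measure.QuasiMeasurePreserving (fun s : ℝ => t₀ + β * s) (volume : Measure ℝ) volume := by
  have h1 : (fun s : ℝ => t₀ + β * s) = (fun y => t₀ + y) ∘ fun s => β * s := rfl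
  rw [h1]
  refine (measurePreserving_add_left volume t₀).quasiMeasurePreserving.comp ⟨measurable_const_mul β, ?_⟩
  rw [Real.map_volume_mul_left hβ.ne']
  exact Measure.smul_absolutelyContinuous

/-- Transport of a.e.-in-time statements on an interval along `s ↦ t₀ + β s` (`β > 0`):
if `P t` for a.e. `t ∈ (t₀ + βa, t₀ + βb)` then `P (t₀ + β s)` for a.e. `s ∈ (a, b)`. [folklore] -/
theorem ae_restrict_Ioo_comp_time_affine {β : ℝ} (hβ : 0 < β) (t₀ a b : ℝ) {P : ℝ → Prop}
    (h : ∀ᵐ t ∂(volume.restrict (Ioo (t₀ + β * a) (t₀ + β * b))), P t) :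
    ∀ᵐ s ∂(volume.restrict (Ioo a b)), P (t₀ + β * s) := by
  rw [ae_restrict_iff' measurableSet_Ioo] at h ⊢
  have h2 := (quasiMeasurePreserving_time_affine hβ t₀).ae h
  filter_upwards [h2] with s hs hsab
  exact hs ⟨by nlinarith [hsab.1], by nlinarith [hsab.2]⟩

end OneVariable

/-! ### Pull-back of space–time fields and the chain rules -/

section Pull

variable {E : Type*} [NormedAddCommGroup E] [InnerProductSpace ℝ E]
variable {F : Type*}

/-- The pull-back `(ψ ∘ Φ)(s, y) = ψ(t₀ + β s, x₀ + γ y)` of a space–time field (time first)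
along the affine map `Φ = stAffine β γ t₀ x₀`. The rescaled velocity of the parabolic scaling is
`α • stPull β γ t₀ x₀ u` (Escauriaza–Seregin–Šverák 2003, §3). [cite: EscauriazaSereginSverak2003, §3] -/
def stPull (β γ t₀ : ℝ) (x₀ : E) (ψ : ℝ → E → F) : ℝ → E → F :=
  fun s y => ψ (t₀ + β * s) (x₀ + γ • y)

/-- Unfolding `stPull`. [folklore] -/
@[simp]
theorem stPull_apply (β γ t₀ : ℝ) (x₀ : E) (ψ : ℝ → E → F) (s : ℝ) (y : E) :
    stPull β γ t₀ x₀ ψ s y = ψ (t₀ + β * s) (x₀ + γ • y) :=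
  rfl

/-- `uncurry (ψ ∘ Φ) = uncurry ψ ∘ Φ`. [folklore] -/
theorem uncurry_stPull (β γ t₀ : ℝ) (x₀ : E) (ψ : ℝ → E → F) :
    uncurry (stPull β γ t₀ x₀ ψ) = uncurry ψ ∘ stAffine β γ t₀ x₀ := by
  funext z; rfl

/-- `uncurry (ψ ∘ Φ) z = uncurry ψ (Φ z)`. [folklore] -/
theorem uncurry_stPull_apply (β γ t₀ : ℝ) (x₀ : E) (ψ : ℝ → E → F) (z : ℝ × E) :
    uncurry (stPull β γ t₀ x₀ ψ) z = uncurry ψ (stAffine β γ t₀ x₀ z) :=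
  rfl

/-- Pulling back along `Φ` and then along `Φ⁻¹` is the identity. [folklore] -/
theorem stPull_stPull_symm {β γ : ℝ} (hβ : β ≠ 0) (hγ : γ ≠ 0) (t₀ : ℝ) (x₀ : E)
    (ψ : ℝ → E → F) :
    stPull β γ t₀ x₀ (stPull β⁻¹ γ⁻¹ (-(β⁻¹ * t₀)) (-(γ⁻¹ • x₀)) ψ) = ψ := by
  funext s y
  simp only [stPull_apply]
  congr 1
  · field_simp; ring
  · simp only [smul_add, smul_smul, inv_mul_cancel₀ hγ, one_smul]; abel

/-- Pulling back along `Φ⁻¹` and then along `Φ` is the identity. [folklore] -/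
theorem stPull_symm_stPull {β γ : ℝ} (hβ : β ≠ 0) (hγ : γ ≠ 0) (t₀ : ℝ) (x₀ : E)
    (ψ : ℝ → E → F) :
    stPull β⁻¹ γ⁻¹ (-(β⁻¹ * t₀)) (-(γ⁻¹ • x₀)) (stPull β γ t₀ x₀ ψ) = ψ := by
  funext s y
  simp only [stPull_apply]
  congr 1
  · field_simp; ring
  · simp only [smul_add, smul_neg, smul_smul, mul_inv_cancel₀ hγ, one_smul]; abel

/-- The pull-back along `Φ⁻¹`, evaluated at `Φ(s, y)`, returns `ψ(s, y)`. [folklore] -/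
theorem stPull_symm_apply_stAffine {β γ : ℝ} (hβ : β ≠ 0) (hγ : γ ≠ 0) (t₀ : ℝ) (x₀ : E)
    (ψ : ℝ → E → F) (s : ℝ) (y : E) :
    stPull β⁻¹ γ⁻¹ (-(β⁻¹ * t₀)) (-(γ⁻¹ • x₀)) ψ (t₀ + β * s) (x₀ + γ • y) = ψ s y := by
  have := congrArg (fun (χ : ℝ → E → F) => χ s y) (stPull_stPull_symm hβ hγ t₀ x₀ ψ)
  simpa only [stPull_apply] using this

variable [NormedAddCommGroup F] [NormedSpace ℝ F]

/-- **Chain rule in time**: `∂ₛ (ψ ∘ Φ)(s, y) = β ∂ₜψ(Φ(s, y))` (no differentiability needed,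
both sides being junk `0` together). [folklore] -/
theorem timeDeriv_stPull (β γ t₀ : ℝ) (x₀ : E) (ψ : ℝ → E → F) (s : ℝ) (y : E) :
    timeDeriv (stPull β γ t₀ x₀ ψ) s y = β • timeDeriv ψ (t₀ + β * s) (x₀ + γ • y) := by
  simp only [timeDeriv_apply, stPull_apply]
  have h1 : (fun r => ψ (t₀ + β * r) (x₀ + γ • y)) =
      ((fun r' => ψ (t₀ + r') (x₀ + γ • y)) <| β * ·) := rfl
  rw [h1, deriv_comp_mul_left β (fun r' => ψ (t₀ + r') (x₀ + γ • y)) s]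
  congr 1
  exact deriv_comp_const_add (f := fun t => ψ t (x₀ + γ • y)) (a := t₀) (x := β * s)

/-- **Chain rule in space**: `D_y (ψ ∘ Φ)(s, ·)(y) = γ D_x ψ(t, ·)(x)` at `(t, x) = Φ(s, y)`
(no differentiability needed). [folklore] -/
theorem fderiv_stPull (β γ t₀ : ℝ) (x₀ : E) (ψ : ℝ → E → F) (s : ℝ) (y : E) :
    fderiv ℝ (stPull β γ t₀ x₀ ψ s) y = γ • fderiv ℝ (ψ (t₀ + β * s)) (x₀ + γ • y) := by
  have h := fderiv_comp_smul (𝕜 := ℝ) (f := fun x => ψ (t₀ + β * s) (x₀ + x)) (x := y) γ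
  rw [fderiv_comp_add_left] at h
  exact h

/-- Chain rule for the convective derivative of a pulled-back field along any vector field `a`:
`((a·∇)(ψ ∘ Φ))(s, y) = γ Dψ(Φ(s,y))[a(y)]`. [folklore] -/
theorem convect_stPull {F' : Type*} [NormedAddCommGroup F'] [InnerProductSpace ℝ F'] (β γ t₀ : ℝ)
    (x₀ : E) (a : E → E) (ψ : ℝ → E → F') (s : ℝ) (y : E) :
    convect a (stPull β γ t₀ x₀ ψ s) y = γ • fderiv ℝ (ψ (t₀ + β * s)) (x₀ + γ • y) (a y) := by
  rw [convect_apply, fderiv_stPull]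
  rfl

/-- Chain rule for the gradient of a pulled-back scalar field:
`∇(θ ∘ Φ)(s, y) = γ ∇θ(Φ(s, y))`. [folklore] -/
theorem gradient_stPull [CompleteSpace E] (β γ t₀ : ℝ) (x₀ : E) (θ : ℝ → E → ℝ) (s : ℝ)
    (y : E) :
    gradient (stPull β γ t₀ x₀ θ s) y = γ • gradient (θ (t₀ + β * s)) (x₀ + γ • y) := by
  rw [gradient, gradient, fderiv_stPull, map_smulₛₗ]
  simp

/-- Chain rule for the divergence of a pulled-back vector field:
`div (ψ ∘ Φ)(s, y) = γ div ψ(Φ(s, y))`. [folklore] -/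
theorem divergence_stPull [FiniteDimensional ℝ E] (β γ t₀ : ℝ) (x₀ : E) (ψ : ℝ → E → E)
    (s : ℝ) (y : E) :
    VectorCalculus.divergence (stPull β γ t₀ x₀ ψ s) y = γ * VectorCalculus.divergence (ψ (t₀ + β * s)) (x₀ + γ • y) := by
  rw [VectorCalculus.divergence, VectorCalculus.divergence, fderiv_stPull, ContinuousLinearMap.toLinearMap_smul,
    LinearMap.map_smul, smul_eq_mul]

/-- Chain rule for the Laplacian of a pulled-back field with `C²` slice:
`Δ_y (ψ ∘ Φ)(s, ·)(y) = γ² Δ_x ψ(t, ·)(x)` at `(t, x) = Φ(s, y)`. [folklore] -/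
theorem laplacian_stPull [FiniteDimensional ℝ E] (β γ t₀ : ℝ) (x₀ : E) (ψ : ℝ → E → F)
    (s : ℝ) (y : E) (h : ContDiff ℝ 2 (ψ (t₀ + β * s))) :
    (Δ (stPull β γ t₀ x₀ ψ s)) y = γ ^ 2 • (Δ (ψ (t₀ + β * s))) (x₀ + γ • y) := by
  set b := stdOrthonormalBasis ℝ E
  rw [InnerProductSpace.laplacian_eq_iteratedFDeriv_orthonormalBasis _ b,
    InnerProductSpace.laplacian_eq_iteratedFDeriv_orthonormalBasis _ b]
  simp only
  rw [Finset.smul_sum]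
  refine Finset.sum_congr rfl fun i _ => ?_
  set g : E → F := fun x => ψ (t₀ + β * s) (x₀ + x) with hg
  have hgc : ContDiff ℝ 2 g := h.comp (contDiff_const.add contDiff_id)
  have h1 : stPull β γ t₀ x₀ ψ s = g ∘ (γ • ContinuousLinearMap.id ℝ E) := by
    funext x; simp [g]
  rw [h1, ContinuousLinearMap.iteratedFDeriv_comp_right _ hgc y le_rfl,
    ContinuousMultilinearMap.compContinuousLinearMap_apply]
  have h2 : (fun j : Fin 2 => (γ • ContinuousLinearMap.id ℝ E) (![b i, b i] j)) =
      fun j => γ • ![b i, b i] j := by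
    funext j; simp
  rw [h2, ContinuousMultilinearMap.map_smul_univ, Fin.prod_const, hg,
    iteratedFDeriv_comp_add_left]
  simp

/-- **Pull-back of space–time test fields**: if `ψ ∈ C_c^∞(Q)` then `ψ ∘ Φ ∈ C_c^∞(Φ⁻¹(Q))`
(`β, γ ≠ 0`). [folklore] -/
theorem IsSpaceTimeTestOn.stPull {Q : Opens (ℝ × E)} {ψ : ℝ → E → F}
    (hψ : IsSpaceTimeTestOn Q ψ) {β γ : ℝ} (hβ : β ≠ 0) (hγ : γ ≠ 0) (t₀ : ℝ) (x₀ : E) :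
    IsSpaceTimeTestOn (stPreimage β γ t₀ x₀ Q) (stPull β γ t₀ x₀ ψ) := by
  change FunctionSpaces.IsTestFunctionOn _ (uncurry (FluidPDE.stPull β γ t₀ x₀ ψ))
  rw [uncurry_stPull]
  refine ⟨hψ.contDiff.comp (contDiff_stAffine β γ t₀ x₀), ?_, ?_⟩
  · exact hψ.hasCompactSupport.comp_homeomorph (stAffineHomeomorph hβ hγ t₀ x₀)
  · intro z hz
    have h1 : tsupport (uncurry ψ ∘ stAffine β γ t₀ x₀) ⊆
        stAffine β γ t₀ x₀ ⁻¹' tsupport (uncurry ψ) := by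
      rw [tsupport, Function.support_comp_eq_preimage]
      exact (continuous_stAffine β γ t₀ x₀).closure_preimage_subset _
    exact hψ.tsupport_subset (h1 hz)

/-- Pull-back of test fields along `Φ⁻¹`: if `ψ ∈ C_c^∞(Φ⁻¹(Q))` then `ψ ∘ Φ⁻¹ ∈ C_c^∞(Q)`. [folklore] -/
theorem IsSpaceTimeTestOn.stPull_symm {Q : Opens (ℝ × E)} {ψ : ℝ → E → F} {β γ : ℝ}
    {t₀ : ℝ} {x₀ : E} (hψ : IsSpaceTimeTestOn (stPreimage β γ t₀ x₀ Q) ψ) (hβ : β ≠ 0)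
    (hγ : γ ≠ 0) :
    IsSpaceTimeTestOn Q (FluidPDE.stPull β⁻¹ γ⁻¹ (-(β⁻¹ * t₀)) (-(γ⁻¹ • x₀)) ψ) := by
  have h := IsSpaceTimeTestOn.stPull hψ (inv_ne_zero hβ) (inv_ne_zero hγ) (-(β⁻¹ * t₀))
    (-(γ⁻¹ • x₀))
  rwa [stPreimage_stPreimage_symm hβ hγ] at h

/-- Slices of pulled-back test fields are `C^∞` (hence `C²`), the differentiability input of
`laplacian_stPull`. [folklore] -/
theorem IsSpaceTimeTestOn.contDiff_slice_two {Q : Opens (ℝ × E)} {ψ : ℝ → E → F}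
    (hψ : IsSpaceTimeTestOn Q ψ) (t : ℝ) : ContDiff ℝ 2 (ψ t) :=
  (hψ.contDiff_slice t).of_le (by
    change ((2 : ℕ∞) : WithTop ℕ∞) ≤ ((⊤ : ℕ∞) : WithTop ℕ∞)
    exact_mod_cast le_top)

end Pull

/-! ### Local integrability under the affine map -/

section LocInt

variable {E : Type*} [NormedAddCommGroup E] [InnerProductSpace ℝ E] [FiniteDimensional ℝ E]
  [MeasurableSpace E] [BorelSpace E]
variable {G : Type*} [NormedAddCommGroup G]

/-- Integrability on a set is invariant under the affine change of variables:
`F ∘ Φ` is integrable on `Φ⁻¹(U)` iff `F` is integrable on `U` (`β, γ > 0`). [folklore] -/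
theorem integrableOn_comp_stAffine_iff {β γ : ℝ} (hβ : 0 < β) (hγ : 0 < γ) (t₀ : ℝ) (x₀ : E)
    (F : ℝ × E → G) (U : Set (ℝ × E)) :
    IntegrableOn (F ∘ stAffine β γ t₀ x₀) (stAffine β γ t₀ x₀ ⁻¹' U) volume ↔
      IntegrableOn F U volume := by
  rw [← (measurableEmbedding_stAffine hβ.ne' hγ.ne' t₀ x₀).integrableOn_map_iff,
    map_stAffine_volume hβ hγ, IntegrableOn, Measure.restrict_smul, integrable_smul_measure]
  · rfl
  · simp only [ne_eq, ENNReal.ofReal_eq_zero, not_le]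
    positivity
  · exact ENNReal.ofReal_ne_top

/-- **Local integrability is invariant under the affine change of variables**: if `F` is
locally integrable on `S` then `F ∘ Φ` is locally integrable on `Φ⁻¹(S)` (`β, γ > 0`). [folklore] -/
theorem _root_.MeasureTheory.LocallyIntegrableOn.comp_stAffine {β γ : ℝ} (hβ : 0 < β)
    (hγ : 0 < γ) (t₀ : ℝ) (x₀ : E) {F : ℝ × E → G} {S : Set (ℝ × E)}
    (hF : LocallyIntegrableOn F S volume) :
    LocallyIntegrableOn (F ∘ stAffine β γ t₀ x₀) (stAffine β γ t₀ x₀ ⁻¹' S) volume := by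
  intro z hz
  obtain ⟨U, hU, hFU⟩ := hF (stAffine β γ t₀ x₀ z) hz
  refine ⟨stAffine β γ t₀ x₀ ⁻¹' U, ?_, (integrableOn_comp_stAffine_iff hβ hγ t₀ x₀ F U).2 hFU⟩
  exact ((continuous_stAffine β γ t₀ x₀).continuousWithinAt).preimage_mem_nhdsWithin'' hU rfl

/-- Local integrability of the pulled-back (uncurried) field on `Φ⁻¹(Q)`. [folklore] -/
theorem _root_.MeasureTheory.LocallyIntegrableOn.uncurry_stPull {β γ : ℝ} (hβ : 0 < β)
    (hγ : 0 < γ) (t₀ : ℝ) (x₀ : E) {ψ : ℝ → E → G} {Q : Opens (ℝ × E)}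
    (h : LocallyIntegrableOn (uncurry ψ) (Q : Set (ℝ × E)) volume) :
    LocallyIntegrableOn (uncurry (stPull β γ t₀ x₀ ψ))
      ((stPreimage β γ t₀ x₀ Q : Opens (ℝ × E)) : Set (ℝ × E)) volume := by
  rw [FluidPDE.uncurry_stPull, coe_stPreimage]
  exact h.comp_stAffine hβ hγ t₀ x₀

end LocInt

/-! ### Covariance of distributional solutions -/

section Distributional

variable {E : Type*} [NormedAddCommGroup E] [InnerProductSpace ℝ E] [FiniteDimensional ℝ E]
  [MeasurableSpace E] [BorelSpace E]

omit [FiniteDimensional ℝ E] [MeasurableSpace E] [BorelSpace E] in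
/-- Pointwise form of the rescaled fields. [folklore] -/
theorem smul_stPull_apply {F : Type*} [NormedAddCommGroup F] [NormedSpace ℝ F] (α β γ t₀ : ℝ)
    (x₀ : E) (u : ℝ → E → F) (s : ℝ) (y : E) :
    (α • stPull β γ t₀ x₀ u) s y = α • u (t₀ + β * s) (x₀ + γ • y) :=
  rfl

/-- **Covariance of distributional Navier–Stokes solutions under space–time rescaling.**
If `(u, p)` is a distributional solution with viscosity `ν` and force `f` on the open region
`Q ⊆ ℝ × E`, then for `α, γ > 0`, `β = α γ` and `Φ(s, y) = (t₀ + β s, x₀ + γ y)` the pair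
`w = α u ∘ Φ`, `q = α² p ∘ Φ` is a distributional solution on `Φ⁻¹(Q)` with viscosity `α ν / γ`
and force `α² γ f ∘ Φ` (each term of the weak formulation tested with `ψ` equals `α² γ` times the
corresponding term for `(u, p)` tested with `ψ ∘ Φ⁻¹`, by the chain rule and the change of
variables `dz = β γⁿ dz'`). For `α = γ = R`, `β = R²` this is the Navier–Stokes scaling of
Caffarelli–Kohn–Nirenberg 1982, §2 / Escauriaza–Seregin–Šverák 2003, §3; for `α = R/ν`,
`β = R²/ν`, `γ = R` it normalises the viscosity to `1`. [cite: EscauriazaSereginSverak2003, §3] -/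
theorem IsDistributionalNSSolutionOn.stRescale {Q : Opens (ℝ × E)} {ν : ℝ} {f u : ℝ → E → E}
    {p : ℝ → E → ℝ} (h : IsDistributionalNSSolutionOn Q ν f u p) {α β γ : ℝ} (hα : 0 < α)
    (hγ : 0 < γ) (hβ : β = α * γ) (t₀ : ℝ) (x₀ : E) :
    IsDistributionalNSSolutionOn (stPreimage β γ t₀ x₀ Q) (α * ν / γ)
      ((α ^ 2 * γ) • stPull β γ t₀ x₀ f) (α • stPull β γ t₀ x₀ u) (α ^ 2 • stPull β γ t₀ x₀ p) := by
  have hβ0 : 0 < β := by rw [hβ]; positivity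
  have hu : LocallyIntegrableOn (uncurry u) (Q : Set (ℝ × E)) volume := h.1
  have hu2 : LocallyIntegrableOn (fun z => ‖uncurry u z‖ ^ 2) (Q : Set (ℝ × E)) volume := h.2.1
  have hp : LocallyIntegrableOn (uncurry p) (Q : Set (ℝ × E)) volume := h.2.2.1
  have hdiv := h.2.2.2.1
  have hns := h.2.2.2.2
  refine ⟨?_, ?_, ?_, ?_, ?_⟩
  · have := (hu.uncurry_stPull hβ0 hγ t₀ x₀).smul α
    exact this
  · have h1 : LocallyIntegrableOn ((α ^ 2) • ((fun z => ‖uncurry u z‖ ^ 2) ∘ stAffine β γ t₀ x₀))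
        (stAffine β γ t₀ x₀ ⁻¹' (Q : Set (ℝ × E))) volume :=
      (hu2.comp_stAffine hβ0 hγ t₀ x₀).smul (α ^ 2)
    have heq : (fun z => ‖uncurry (α • stPull β γ t₀ x₀ u) z‖ ^ 2) =
        (α ^ 2) • ((fun z => ‖uncurry u z‖ ^ 2) ∘ stAffine β γ t₀ x₀) := by
      funext z
      simp only [Pi.smul_apply, comp_apply, smul_eq_mul]
      change ‖(α • stPull β γ t₀ x₀ u) z.1 z.2‖ ^ 2 = α ^ 2 * ‖uncurry u (stAffine β γ t₀ x₀ z)‖ ^ 2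
      rw [smul_stPull_apply, norm_smul, mul_pow, Real.norm_eq_abs, sq_abs]
      rfl
    rw [coe_stPreimage, heq]
    exact h1
  · have := (hp.uncurry_stPull hβ0 hγ t₀ x₀).smul (α ^ 2)
    exact this
  · intro θ hθ
    set θ' := stPull β⁻¹ γ⁻¹ (-(β⁻¹ * t₀)) (-(γ⁻¹ • x₀)) θ with hθ'
    have hθ'Q : IsSpaceTimeTestOn Q θ' := hθ.stPull_symm hβ0.ne' hγ.ne'
    have hrepr : θ = stPull β γ t₀ x₀ θ' := (stPull_stPull_symm hβ0.ne' hγ.ne' t₀ x₀ θ).symm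
    set F : ℝ × E → ℝ := fun z' => ⟪u z'.1 z'.2, gradient (θ' z'.1) z'.2⟫ with hF
    have hzero : ∫ z in (Q : Set (ℝ × E)), F z = 0 := hdiv θ' hθ'Q
    have key : ∀ z : ℝ × E,
        ⟪(α • stPull β γ t₀ x₀ u) z.1 z.2, gradient (θ z.1) z.2⟫ =
          (α * γ) * F (stAffine β γ t₀ x₀ z) := by
      intro z
      conv_lhs => rw [hrepr]
      rw [gradient_stPull, smul_stPull_apply, real_inner_smul_left, real_inner_smul_right, hF]
      simp only [stAffine_fst, stAffine_snd]
      ring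
    rw [coe_stPreimage]
    simp_rw [key]
    rw [integral_const_mul, setIntegral_preimage_comp_stAffine hβ0 hγ, hzero, smul_zero,
      mul_zero]
  · intro ψ hψ
    set ψ' := stPull β⁻¹ γ⁻¹ (-(β⁻¹ * t₀)) (-(γ⁻¹ • x₀)) ψ with hψ'
    have hψ'Q : IsSpaceTimeTestOn Q ψ' := hψ.stPull_symm hβ0.ne' hγ.ne'
    have hrepr : ψ = stPull β γ t₀ x₀ ψ' := (stPull_stPull_symm hβ0.ne' hγ.ne' t₀ x₀ ψ).symm
    set F : ℝ × E → ℝ := fun z' => ⟪u z'.1 z'.2, timeDeriv ψ' z'.1 z'.2⟫ +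
        ⟪u z'.1 z'.2, convect (u z'.1) (ψ' z'.1) z'.2⟫ + ν * ⟪u z'.1 z'.2, Δ (ψ' z'.1) z'.2⟫ +
        p z'.1 z'.2 * VectorCalculus.divergence (ψ' z'.1) z'.2 + ⟪f z'.1 z'.2, ψ' z'.1 z'.2⟫ with hF
    have hzero : ∫ z in (Q : Set (ℝ × E)), F z = 0 := hns ψ' hψ'Q
    have key : ∀ z : ℝ × E,
        (⟪(α • stPull β γ t₀ x₀ u) z.1 z.2, timeDeriv ψ z.1 z.2⟫ +
          ⟪(α • stPull β γ t₀ x₀ u) z.1 z.2,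
            convect ((α • stPull β γ t₀ x₀ u) z.1) (ψ z.1) z.2⟫ +
          α * ν / γ * ⟪(α • stPull β γ t₀ x₀ u) z.1 z.2, Δ (ψ z.1) z.2⟫ +
          (α ^ 2 • stPull β γ t₀ x₀ p) z.1 z.2 * VectorCalculus.divergence (ψ z.1) z.2 +
          ⟪((α ^ 2 * γ) • stPull β γ t₀ x₀ f) z.1 z.2, ψ z.1 z.2⟫) =
        (α ^ 2 * γ) * F (stAffine β γ t₀ x₀ z) := by
      intro z
      conv_lhs => rw [hrepr]
      rw [timeDeriv_stPull, convect_stPull,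
        laplacian_stPull _ _ _ _ _ _ _ (hψ'Q.contDiff_slice_two _), divergence_stPull,
        smul_stPull_apply, smul_stPull_apply, stPull_apply, map_smul, hF]
      simp only [stAffine_fst, stAffine_snd, Pi.smul_apply, stPull_apply, smul_eq_mul,
        real_inner_smul_left, real_inner_smul_right, convect_apply]
      rw [hβ]
      field_simp
    rw [coe_stPreimage]
    simp_rw [key]
    rw [integral_const_mul, setIntegral_preimage_comp_stAffine hβ0 hγ, hzero, smul_zero,
      mul_zero]

end Distributional

/-! ### Covariance of weak spatial gradients and of the dissipation -/

section WeakGradient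

variable {E : Type*} [NormedAddCommGroup E] [InnerProductSpace ℝ E] [FiniteDimensional ℝ E]
  [MeasurableSpace E] [BorelSpace E]

/-- Iterated change of variables: `∫ ds ∫ dy F(t₀ + β s, x₀ + γ y) = (β γⁿ)⁻¹ ∫ dt ∫ dx F(t, x)`
(`β, γ > 0`; Bochner, no integrability needed — time and space substitutions separately). [folklore] -/
theorem integral_integral_comp_stAffine {G : Type*} [NormedAddCommGroup G] [NormedSpace ℝ G]
    {β γ : ℝ} (hβ : 0 < β) (hγ : 0 < γ) (t₀ : ℝ) (x₀ : E) (F : ℝ → E → G) :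
    ∫ s, ∫ y, F (t₀ + β * s) (x₀ + γ • y) = (β * γ ^ finrank ℝ E)⁻¹ • ∫ t, ∫ x, F t x := by
  have h1 : ∀ s, ∫ y, F (t₀ + β * s) (x₀ + γ • y) =
      (γ ^ finrank ℝ E)⁻¹ • ∫ x, F (t₀ + β * s) x :=
    fun s => integral_comp_space_affine hγ x₀ _
  simp_rw [h1]
  rw [integral_smul, integral_comp_time_affine hβ t₀ (fun t => ∫ x, F t x), smul_smul, mul_inv,
    mul_comm]

omit [MeasurableSpace E] [BorelSpace E] in
/-- The Frobenius norm is quadratic: `|c L|² = c² |L|²`. [folklore] -/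
theorem frobeniusNormSq_smul {F' : Type*} [NormedAddCommGroup F'] [InnerProductSpace ℝ F']
    (c : ℝ) (L : E →L[ℝ] F') : frobeniusNormSq (c • L) = c ^ 2 * frobeniusNormSq L := by
  unfold frobeniusNormSq
  rw [Finset.mul_sum]
  refine Finset.sum_congr rfl fun i _ => ?_
  rw [smul_apply, norm_smul, mul_pow, Real.norm_eq_abs, sq_abs]

/-- **Covariance of weak spatial gradients under space–time rescaling.** If `G` is a weak
spatial gradient of `u` on `Q`, then `(α γ) • G ∘ Φ` is a weak spatial gradient of `α • u ∘ Φ`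
on `Φ⁻¹(Q)`, `Φ(s, y) = (t₀ + β s, x₀ + γ y)`, `β, γ > 0` (chain rule `∇_y (φ ∘ Φ) = γ (∇φ) ∘ Φ`
on the test function and the change of variables `ds dy = (β γⁿ)⁻¹ dt dx` on both sides of the
integration-by-parts identity; Caffarelli–Kohn–Nirenberg 1982, §2, scaling of (2.1)). [cite: CaffarelliKohnNirenberg1982, §2] -/
theorem HasWeakSpatialGradientOn.stRescale {Q : Opens (ℝ × E)} {u : ℝ → E → E}
    {G : ℝ → E → E →L[ℝ] E} (h : HasWeakSpatialGradientOn Q u G) (α : ℝ) {β γ : ℝ}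
    (hβ : 0 < β) (hγ : 0 < γ) (t₀ : ℝ) (x₀ : E) :
    HasWeakSpatialGradientOn (stPreimage β γ t₀ x₀ Q) (α • stPull β γ t₀ x₀ u)
      ((α * γ) • stPull β γ t₀ x₀ G) where
  locallyIntegrableOn := (h.locallyIntegrableOn.uncurry_stPull hβ hγ t₀ x₀).smul α
  locallyIntegrableOn_grad := (h.locallyIntegrableOn_grad.uncurry_stPull hβ hγ t₀ x₀).smul (α * γ)
  integral_fderiv_mul_inner_eq φ hφ v w := by
    set φ' := stPull β⁻¹ γ⁻¹ (-(β⁻¹ * t₀)) (-(γ⁻¹ • x₀)) φ with hφ'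
    have hφ'Q : IsSpaceTimeTestOn Q φ' := hφ.stPull_symm hβ.ne' hγ.ne'
    have hrepr : φ = stPull β γ t₀ x₀ φ' := (stPull_stPull_symm hβ.ne' hγ.ne' t₀ x₀ φ).symm
    have hid := h.integral_fderiv_mul_inner_eq φ' hφ'Q v w
    set F₁ : ℝ → E → ℝ := fun t x => fderiv ℝ (φ' t) x v * ⟪u t x, w⟫ with hF₁
    set F₂ : ℝ → E → ℝ := fun t x => φ' t x * ⟪G t x v, w⟫ with hF₂
    have key1 : ∀ s y, fderiv ℝ (φ s) y v * ⟪(α • stPull β γ t₀ x₀ u) s y, w⟫ =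
        (α * γ) * F₁ (t₀ + β * s) (x₀ + γ • y) := by
      intro s y
      have e : (α • stPull β γ t₀ x₀ u) s y = α • u (t₀ + β * s) (x₀ + γ • y) := rfl
      conv_lhs => rw [hrepr]
      rw [fderiv_stPull, e, real_inner_smul_left, FunLike.coe_smul, Pi.smul_apply,
        smul_eq_mul, hF₁]
      ring
    have key2 : ∀ s y, φ s y * ⟪((α * γ) • stPull β γ t₀ x₀ G) s y v, w⟫ =
        (α * γ) * F₂ (t₀ + β * s) (x₀ + γ • y) := by
      intro s y
      have e : ((α * γ) • stPull β γ t₀ x₀ G) s y v = (α * γ) • G (t₀ + β * s) (x₀ + γ • y) v :=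
        rfl
      conv_lhs => rw [hrepr]
      rw [e, real_inner_smul_left, stPull_apply, hF₂]
      ring
    have hid' : ∫ t, ∫ x, F₁ t x = -∫ t, ∫ x, F₂ t x := hid
    simp_rw [key1, key2, integral_const_mul]
    rw [integral_integral_comp_stAffine hβ hγ t₀ x₀ F₁,
      integral_integral_comp_stAffine hβ hγ t₀ x₀ F₂, hid']
    simp only [smul_eq_mul]
    ring

/-- **Covariance of the dissipation**: `∫⁻_{Φ⁻¹ S} |c G ∘ Φ|² = c² (β γⁿ)⁻¹ ∫⁻_S |G|²`. [folklore] -/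
theorem setLIntegral_frobeniusNormSq_stRescale {β γ : ℝ} (hβ : 0 < β) (hγ : 0 < γ) (t₀ : ℝ)
    (x₀ : E) (c : ℝ) (G : ℝ → E → E →L[ℝ] E) (S : Set (ℝ × E)) :
    ∫⁻ z in stAffine β γ t₀ x₀ ⁻¹' S,
        ENNReal.ofReal (frobeniusNormSq ((c • stPull β γ t₀ x₀ G) z.1 z.2)) =
      ENNReal.ofReal (c ^ 2) * ENNReal.ofReal (β * γ ^ finrank ℝ E)⁻¹ *
        ∫⁻ z in S, ENNReal.ofReal (frobeniusNormSq (G z.1 z.2)) := by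
  set Ff : ℝ × E → ℝ≥0∞ := fun z' => ENNReal.ofReal (frobeniusNormSq (G z'.1 z'.2)) with hFf
  have h1 : ∀ z : ℝ × E, ENNReal.ofReal (frobeniusNormSq ((c • stPull β γ t₀ x₀ G) z.1 z.2)) =
      ENNReal.ofReal (c ^ 2) * Ff (stAffine β γ t₀ x₀ z) := by
    intro z
    have e : (c • stPull β γ t₀ x₀ G) z.1 z.2 = c • G (t₀ + β * z.1) (x₀ + γ • z.2) := rfl
    rw [e, frobeniusNormSq_smul, ENNReal.ofReal_mul (sq_nonneg _), hFf]
    rfl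
  simp_rw [h1]
  rw [lintegral_const_mul' _ _ ENNReal.ofReal_ne_top,
    setLIntegral_preimage_comp_stAffine hβ hγ t₀ x₀ Ff, mul_assoc]

/-- **Covariance of powers of the field**: `∫⁻_{Φ⁻¹ S} ‖α u ∘ Φ‖ₑ^r = ‖α‖ₑ^r (β γⁿ)⁻¹ ∫⁻_S ‖u‖ₑ^r`
for a real exponent `r ≥ 0` and any normed-space-valued field. [folklore] -/
theorem setLIntegral_enorm_rpow_stRescale {F : Type*} [NormedAddCommGroup F] [NormedSpace ℝ F]
    {β γ : ℝ} (hβ : 0 < β) (hγ : 0 < γ) (t₀ : ℝ) (x₀ : E) (α : ℝ) (u : ℝ → E → F)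
    (S : Set (ℝ × E)) {r : ℝ} (hr : 0 ≤ r) :
    ∫⁻ z in stAffine β γ t₀ x₀ ⁻¹' S, ‖(α • stPull β γ t₀ x₀ u) z.1 z.2‖ₑ ^ r =
      ‖α‖ₑ ^ r * ENNReal.ofReal (β * γ ^ finrank ℝ E)⁻¹ * ∫⁻ z in S, ‖u z.1 z.2‖ₑ ^ r := by
  set Ff : ℝ × E → ℝ≥0∞ := fun z' => ‖u z'.1 z'.2‖ₑ ^ r with hFf
  have h1 : ∀ z : ℝ × E, ‖(α • stPull β γ t₀ x₀ u) z.1 z.2‖ₑ ^ r =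
      ‖α‖ₑ ^ r * Ff (stAffine β γ t₀ x₀ z) := by
    intro z
    have e : (α • stPull β γ t₀ x₀ u) z.1 z.2 = α • u (t₀ + β * z.1) (x₀ + γ • z.2) := rfl
    rw [e, enorm_smul, ENNReal.mul_rpow_of_nonneg _ _ hr, hFf]
    rfl
  simp_rw [h1]
  rw [lintegral_const_mul' _ _ (ENNReal.rpow_ne_top_of_nonneg hr enorm_ne_top),
    setLIntegral_preimage_comp_stAffine hβ hγ t₀ x₀ Ff, mul_assoc]

/-- The same for natural-number powers (`‖v‖ₑ ^ 2`, `‖v‖ₑ ^ 3`). [folklore] -/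
theorem setLIntegral_enorm_pow_stRescale {F : Type*} [NormedAddCommGroup F] [NormedSpace ℝ F]
    {β γ : ℝ} (hβ : 0 < β) (hγ : 0 < γ) (t₀ : ℝ) (x₀ : E) (α : ℝ) (u : ℝ → E → F)
    (S : Set (ℝ × E)) (n : ℕ) :
    ∫⁻ z in stAffine β γ t₀ x₀ ⁻¹' S, ‖(α • stPull β γ t₀ x₀ u) z.1 z.2‖ₑ ^ n =
      ‖α‖ₑ ^ n * ENNReal.ofReal (β * γ ^ finrank ℝ E)⁻¹ * ∫⁻ z in S, ‖u z.1 z.2‖ₑ ^ n := by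
  set Ff : ℝ × E → ℝ≥0∞ := fun z' => ‖u z'.1 z'.2‖ₑ ^ n with hFf
  have h1 : ∀ z : ℝ × E, ‖(α • stPull β γ t₀ x₀ u) z.1 z.2‖ₑ ^ n =
      ‖α‖ₑ ^ n * Ff (stAffine β γ t₀ x₀ z) := by
    intro z
    have e : (α • stPull β γ t₀ x₀ u) z.1 z.2 = α • u (t₀ + β * z.1) (x₀ + γ • z.2) := rfl
    rw [e, enorm_smul, mul_pow, hFf]
    rfl
  simp_rw [h1]
  rw [lintegral_const_mul' _ _ (ENNReal.pow_ne_top enorm_ne_top),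
    setLIntegral_preimage_comp_stAffine hβ hγ t₀ x₀ Ff, mul_assoc]

/-- **Covariance of sliced bounds**: a bound `∫_{B(x₁, ρ)} F(t, ·) ≤ C` for a.e.
`t ∈ (t₀ + βa, t₀ + βb)` becomes `∫_{B(γ⁻¹(x₁ - x₀), ρ/γ)} F(t₀ + βs, x₀ + γ ·) ≤ (γⁿ)⁻¹ C`
for a.e. `s ∈ (a, b)`. [folklore] -/
theorem ae_sliced_setLIntegral_ball_stRescale {β γ : ℝ} (hβ : 0 < β) (hγ : 0 < γ) (t₀ : ℝ)
    (x₀ x₁ : E) (ρ a b : ℝ) (F : ℝ → E → ℝ≥0∞) {C : ℝ≥0∞}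
    (h : ∀ᵐ t ∂(volume.restrict (Ioo (t₀ + β * a) (t₀ + β * b))),
      ∫⁻ x in ball x₁ ρ, F t x ≤ C) :
    ∀ᵐ s ∂(volume.restrict (Ioo a b)),
      ∫⁻ y in ball (γ⁻¹ • (x₁ - x₀)) (ρ / γ), F (t₀ + β * s) (x₀ + γ • y) ≤
        ENNReal.ofReal (γ ^ finrank ℝ E)⁻¹ * C := by
  filter_upwards [ae_restrict_Ioo_comp_time_affine hβ t₀ a b h] with s hs
  rw [← space_affine_preimage_ball hγ x₀ x₁ ρ,
    setLIntegral_preimage_comp_space_affine hγ x₀ (F (t₀ + β * s)) (ball x₁ ρ)]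
  exact mul_le_mul_right hs _

/-- Transport of a.e. statements back along `Φ`: if `P (Φ z)` holds for a.e. `z ∈ Φ⁻¹(S)`, then
`P` holds a.e. on `S` (`Φ` is a measurable bijection scaling Lebesgue measure). [folklore] -/
theorem ae_restrict_of_ae_restrict_preimage_stAffine {β γ : ℝ} (hβ : 0 < β) (hγ : 0 < γ)
    (t₀ : ℝ) (x₀ : E) {S : Set (ℝ × E)} {P : ℝ × E → Prop}
    (h : ∀ᵐ z ∂(volume.restrict (stAffine β γ t₀ x₀ ⁻¹' S)), P (stAffine β γ t₀ x₀ z)) :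
    ∀ᵐ z ∂(volume.restrict S), P z := by
  have hme := measurableEmbedding_stAffine hβ.ne' hγ.ne' t₀ x₀
  have h2 : ∀ᵐ z ∂(Measure.map (stAffine β γ t₀ x₀)
      (volume.restrict (stAffine β γ t₀ x₀ ⁻¹' S))), P z := hme.ae_map_iff.2 h
  rw [map_stAffine_volume_restrict_preimage hβ hγ] at h2
  have hc : ENNReal.ofReal (β * γ ^ finrank ℝ E)⁻¹ ≠ 0 :=
    (ENNReal.ofReal_pos.2 (by positivity)).ne'
  exact (Measure.ae_ennreal_smul_measure_iff hc).1 h2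

/-- A.e. equality is transported along `Φ`: `f =ᵐ[S] g` implies `f ∘ Φ =ᵐ[Φ⁻¹ S] g ∘ Φ`. [folklore] -/
theorem ae_eq_restrict_comp_stAffine {F : Type*} {β γ : ℝ} (hβ : 0 < β) (hγ : 0 < γ) (t₀ : ℝ)
    (x₀ : E) {S : Set (ℝ × E)} {f g : ℝ × E → F} (h : f =ᵐ[volume.restrict S] g) :
    f ∘ stAffine β γ t₀ x₀ =ᵐ[volume.restrict (stAffine β γ t₀ x₀ ⁻¹' S)]
      g ∘ stAffine β γ t₀ x₀ :=
  ae_restrict_preimage_stAffine hβ hγ t₀ x₀ h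

end WeakGradient

end Literature.Analysis.FluidPDE
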